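import Literature.NumberTheory.LFunctions.ClassGroupLFunctionZeroSymmetry
import Literature.NumberTheory.LFunctions.ClassGroupLFunctionLocalL0
import Literature.NumberTheory.LFunctions.DedekindZetaPartialFraction
import HarnessLib

/-!
# Zeros of `L₀(s, χ)` and `ζ₁_K` in unit windows, and good heights, uniformly in the field

Topic `Literature/NumberTheory/LFunctions`, namespace `Literature.NumberTheory.LFunctions.NumberField`.
Everything here is PROVED (theorems only; no named facts).

The class-group analogue of the tree's `ExplicitPsiChar.exists_sum_window_le` /
`ExplicitPsiChar.exists_goodHeight` (Montgomery–Vaughan Thm. 10.17, Lemma 12.7), with the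
logarithmic scale `discBound K t = log|d_K| + 3n_K + (n_K + 1) log(|t| + 7)`:

* `sum_window_classGroupLFunction₀_le` — for `χ ≠ 1` and a finite set `P` of zeros of `L₀(s, χ)`
  with `0 < β < 1`, `|γ − τ| ≤ 1/2`: `Σ_{ρ ∈ P} m(ρ) ≤ 256 · discBound K τ` (the zeros with
  `β ≥ 1/2` lie in the Jensen disc `|s − (2 + iτ)| ≤ 31/16` of `L₀(·, χ)`, the others are reflected
  by `ρ ↦ 1 − ρ` into that of `L₀(·, χ⁻¹)` at height `−τ`, `ClassGroupLFunctionZeroSymmetry`);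
* `sum_window_dedekindZeta₁_le` — the same for `ζ_K` (`64 · discBound`);
* `finite_zeros_classGroupLFunction₀`, `finite_zeros_dedekindZeta₁` — the zeros in a compact set are finite;
* `exists_goodHeight_classGroupLFunction₀`, `exists_goodHeight_dedekindZeta₁` — every `[τ₀, τ₀+1]`,
  `τ₀ ≥ 0`, contains `T` with `||γ| − T| ≥ c₀/discBound K T` for every non-trivial zero (absolute `c₀`).

## References

* H. L. Montgomery, R. C. Vaughan, *Multiplicative Number Theory I*, Thm. 10.17, Lemma 12.7. [MontgomeryVaughan2007]
* J. C. Lagarias, A. M. Odlyzko, in *Algebraic Number Fields* (1977), Lemma 5.4. [LagariasOdlyzko1977]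
-/

noncomputable section

open scoped NumberField nonZeroDivisors Real
open NumberField Complex Filter Topology Set Metric Finset

namespace Literature.NumberTheory.LFunctions.NumberField

open Literature.NumberTheory.LFunctions.LogFreeLocal

variable {K : Type*} [Field K] [NumberField K]

/-! ### Windows -/

omit [NumberField K] in
/-- A zero with `1/2 ≤ β ≤ 2` (say) and `|γ − τ| ≤ 1/2` lies in the disc `|s − (2 + iτ)| ≤ 31/16`. [folklore] -/
theorem mem_closedBall_of_window {ρ : ℂ} {τ : ℝ} (h1 : 1 / 2 ≤ ρ.re) (h2 : ρ.re ≤ 2) (h3 : |ρ.im - τ| ≤ 1 / 2) :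
    ρ ∈ closedBall (2 + (τ : ℂ) * I) (31 / 16) := by
  rw [mem_closedBall, dist_eq_norm]
  have hre : (ρ - (2 + (τ : ℂ) * I)).re = ρ.re - 2 := by simp
  have him : (ρ - (2 + (τ : ℂ) * I)).im = ρ.im - τ := by simp
  have hsq : ‖ρ - (2 + (τ : ℂ) * I)‖ ^ 2 ≤ (31 / 16 : ℝ) ^ 2 := by
    rw [Complex.sq_norm, Complex.normSq_apply, hre, him]
    have ha : (ρ.re - 2) * (ρ.re - 2) ≤ (3 / 2) ^ 2 := by nlinarith
    have hb : (ρ.im - τ) * (ρ.im - τ) ≤ (1 / 2) ^ 2 := by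
      have := abs_le.1 h3; nlinarith
    nlinarith
  nlinarith [norm_nonneg (ρ - (2 + (τ : ℂ) * I))]

omit [NumberField K] in
/-- `discBound K (−τ) = discBound K τ`. [folklore] -/
theorem discBound_neg (K : Type*) [Field K] [NumberField K] (τ : ℝ) : discBound K (-τ) = discBound K τ := by
  rw [discBound, discBound, abs_neg]

/-- The multiplicity of the entire `L₀(·, χ)` under the reflection: for a non-trivial zero `ρ`
(`0 < β < 1`), `m_χ(ρ) = m_{χ⁻¹}(1 − ρ)`. [folklore] -/
theorem zeroOrder_classGroupLFunction₀_reflect {χ : ClassGroup (𝓞 K) →* ℂˣ} (hχ : χ ≠ 1) {ρ : ℂ}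
    (h1 : 0 < ρ.re) (h2 : ρ.re < 1) :
    zeroOrder (classGroupLFunction₀ K χ) ρ = zeroOrder (classGroupLFunction₀ K χ⁻¹) (1 - ρ) := by
  have hs : ∀ n : ℤ, 1 - ρ ≠ n := by
    refine ne_int_of_mem_strip ?_ ?_
    · simp only [sub_re, one_re]; linarith
    · simp only [sub_re, one_re]; linarith
  have h := analyticOrderNatAt_classGroupLFunction₀_one_sub hχ hs
  rw [sub_sub_cancel] at h
  rw [zeroOrder, zeroOrder, h]

/-- **Zeros in a unit window, uniformly in the field** (`χ ≠ 1`): for every finite set `P` of zeros of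
`L₀(s, χ)` with `0 < β < 1`, `|γ − τ| ≤ 1/2`: `Σ_{ρ ∈ P} m(ρ) ≤ 256 · discBound K τ`.
[cite: MontgomeryVaughan2007, Theorem 10.17] -/
theorem sum_window_classGroupLFunction₀_le {χ : ClassGroup (𝓞 K) →* ℂˣ} (hχ : χ ≠ 1) (τ : ℝ) (P : Finset ℂ)
    (hP : ∀ ρ ∈ P, classGroupLFunction₀ K χ ρ = 0 ∧ 0 < ρ.re ∧ ρ.re < 1 ∧ |ρ.im - τ| ≤ 1 / 2) :
    ∑ ρ ∈ P, (zeroOrder (classGroupLFunction₀ K χ) ρ : ℝ) ≤ 256 * discBound K τ := by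
  classical
  have hχ' : χ⁻¹ ≠ 1 := fun h ↦ hχ (by
    ext C
    have := congrArg (fun ψ : ClassGroup (𝓞 K) →* ℂˣ ↦ ((ψ C)⁻¹ : ℂˣ)) h
    simpa using this)
  set f := classGroupLFunction₀ K χ with hf
  set g := classGroupLFunction₀ K χ⁻¹ with hg
  have hdf : Differentiable ℂ f := differentiable_classGroupLFunction₀ χ
  have hdg : Differentiable ℂ g := differentiable_classGroupLFunction₀ χ⁻¹
  have hfc : f (2 + (τ : ℂ) * I) ≠ 0 := classGroupLFunction₀_two_add_ne_zero hχ τ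
  have hgc : g (2 + ((-τ : ℝ) : ℂ) * I) ≠ 0 := classGroupLFunction₀_two_add_ne_zero hχ' (-τ)
  rw [← sum_filter_add_sum_filter_not P (fun ρ : ℂ ↦ (1 / 2 : ℝ) ≤ ρ.re),
    show (256 : ℝ) * discBound K τ = 128 * discBound K τ + 128 * discBound K (-τ) by rw [discBound_neg]; ring]
  refine add_le_add ?_ ?_
  · -- right half
    have hsub : P.filter (fun ρ : ℂ ↦ (1 / 2 : ℝ) ≤ ρ.re) ⊆ discZeros f τ := by
      intro ρ hρ
      rw [mem_filter] at hρ
      obtain ⟨h0, -, h2, h3⟩ := hP ρ hρ.1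
      exact (mem_discZeros hdf hfc).2 ⟨mem_closedBall_of_window hρ.2 (by linarith) h3, h0⟩
    calc ∑ ρ ∈ P.filter (fun ρ : ℂ ↦ (1 / 2 : ℝ) ≤ ρ.re), (zeroOrder f ρ : ℝ)
        = ∑ ρ ∈ P.filter (fun ρ : ℂ ↦ (1 / 2 : ℝ) ≤ ρ.re), (discDivisor f τ ρ : ℝ) := by
          refine sum_congr rfl fun ρ hρ ↦ ?_
          rw [discDivisor_eq_zeroOrder hdf hfc ((mem_discZeros hdf hfc).1 (hsub hρ)).1]; norm_cast
      _ ≤ ∑ ρ ∈ discZeros f τ, (discDivisor f τ ρ : ℝ) :=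
          sum_le_sum_of_subset_of_nonneg hsub fun ρ _ _ ↦ by exact_mod_cast discDivisor_nonneg hdf _ ρ
      _ ≤ 128 * discBound K τ := sum_discDivisor_classGroupLFunction₀_le hχ τ
  · -- left half: reflect
    set P' := P.filter (fun ρ : ℂ ↦ ¬ (1 / 2 : ℝ) ≤ ρ.re) with hP'
    have hinj : Set.InjOn (fun ρ : ℂ ↦ 1 - ρ) ↑P' := fun a _ b _ h ↦ sub_right_injective h
    have heq : ∑ ρ ∈ P', (zeroOrder f ρ : ℝ) = ∑ u ∈ P'.image (fun ρ : ℂ ↦ 1 - ρ), (zeroOrder g u : ℝ) := by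
      rw [sum_image hinj]
      refine sum_congr rfl fun ρ hρ ↦ ?_
      obtain ⟨-, h1, h2, -⟩ := hP ρ (mem_filter.1 hρ).1
      rw [zeroOrder_classGroupLFunction₀_reflect hχ h1 h2]
    have hsub : P'.image (fun ρ : ℂ ↦ 1 - ρ) ⊆ discZeros g (-τ) := by
      intro u hu
      obtain ⟨ρ, hρ, rfl⟩ := mem_image.1 hu
      obtain ⟨h0, h1, h2, h3⟩ := hP ρ (mem_filter.1 hρ).1
      have hlt : ρ.re < 1 / 2 := not_le.1 (mem_filter.1 hρ).2
      refine (mem_discZeros hdg hgc).2 ⟨?_, ?_⟩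
      · refine mem_closedBall_of_window (τ := -τ) ?_ ?_ ?_
        · simp only [sub_re, one_re]; linarith
        · simp only [sub_re, one_re]; linarith
        · simp only [sub_im, one_im, zero_sub]
          rw [show -ρ.im - -τ = -(ρ.im - τ) by ring, abs_neg]; exact h3
      · have hs : ∀ n : ℤ, ρ ≠ n := ne_int_of_mem_strip h1 h2
        have hinv : χ⁻¹⁻¹ = χ := by ext C; simp
        exact (classGroupLFunction₀_one_sub_eq_zero_iff hχ' hs).2 (by rw [hinv]; exact h0)
    rw [heq]
    calc ∑ u ∈ P'.image (fun ρ : ℂ ↦ 1 - ρ), (zeroOrder g u : ℝ)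
        = ∑ u ∈ P'.image (fun ρ : ℂ ↦ 1 - ρ), (discDivisor g (-τ) u : ℝ) := by
          refine sum_congr rfl fun u hu ↦ ?_
          rw [discDivisor_eq_zeroOrder hdg hgc ((mem_discZeros hdg hgc).1 (hsub hu)).1]; norm_cast
      _ ≤ ∑ u ∈ discZeros g (-τ), (discDivisor g (-τ) u : ℝ) :=
          sum_le_sum_of_subset_of_nonneg hsub fun u _ _ ↦ by exact_mod_cast discDivisor_nonneg hdg _ u
      _ ≤ 128 * discBound K (-τ) := sum_discDivisor_classGroupLFunction₀_le hχ' (-τ)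

/-! ### Finiteness of the zeros in compact sets -/

/-- The zeros of the entire, not identically vanishing `L₀(·, χ)` (`χ ≠ 1`) in a compact set are finite. [folklore] -/
theorem finite_zeros_classGroupLFunction₀ {χ : ClassGroup (𝓞 K) →* ℂˣ} (hχ : χ ≠ 1) {S : Set ℂ} (hS : IsCompact S) :
    (S ∩ classGroupLFunction₀ K χ ⁻¹' {0}).Finite := by
  have han : AnalyticOnNhd ℂ (classGroupLFunction₀ K χ) univ :=
    (differentiable_classGroupLFunction₀ χ).differentiableOn.analyticOnNhd isOpen_univ
  have h2 : classGroupLFunction₀ K χ (2 + ((0 : ℝ) : ℂ) * I) ≠ 0 := classGroupLFunction₀_two_add_ne_zero hχ 0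
  have hcod := han.preimage_zero_mem_codiscreteWithin (x := 2 + ((0 : ℝ) : ℂ) * I) h2 (mem_univ _) isConnected_univ
  have hclosed : IsClosed (classGroupLFunction₀ K χ ⁻¹' {0}) := by
    simpa using (mem_codiscrete'.mp hcod).1
  have hdisc : IsDiscrete (classGroupLFunction₀ K χ ⁻¹' {0}) := by
    simpa using (mem_codiscrete'.mp hcod).2
  exact (hS.inter_right hclosed).finite (hdisc.mono inter_subset_right)

/-- The non-trivial zeros of `L₀(·, χ)` with `|γ| ≤ Y` form a finite set. [folklore] -/
theorem finite_zeroBox_classGroupLFunction₀ {χ : ClassGroup (𝓞 K) →* ℂˣ} (hχ : χ ≠ 1) (Y : ℝ) :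
    {ρ : ℂ | classGroupLFunction₀ K χ ρ = 0 ∧ 0 < ρ.re ∧ ρ.re < 1 ∧ |ρ.im| ≤ Y}.Finite := by
  refine (finite_zeros_classGroupLFunction₀ hχ ((isCompact_Icc (a := (0:ℝ)) (b := 1)).reProdIm
    (isCompact_Icc (a := -Y) (b := Y)))).subset ?_
  rintro ρ ⟨h0, h1, h2, h3⟩
  exact ⟨Complex.mem_reProdIm.2 ⟨⟨h1.le, h2.le⟩, abs_le.1 h3⟩, h0⟩

/-! ### Good heights -/

omit [NumberField K] in
/-- `discBound K (τ₀ + 1/2) ≤ 2 · discBound K T` for `T ∈ [τ₀, τ₀ + 1]`, `τ₀ ≥ 0`. [folklore] -/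
theorem discBound_le_two_mul (K : Type*) [Field K] [NumberField K] {τ₀ T : ℝ} (hτ₀ : 0 ≤ τ₀) (hT : τ₀ ≤ T) :
    discBound K (τ₀ + 1 / 2) ≤ 2 * discBound K T := by
  rw [discBound, discBound]
  have hlog : Real.log (|τ₀ + 1 / 2| + 7) ≤ 2 * Real.log (|T| + 7) := by
    rw [abs_of_nonneg (by linarith), abs_of_nonneg (by linarith)]
    calc Real.log (τ₀ + 1 / 2 + 7) ≤ Real.log ((T + 7) ^ 2) := by
          refine Real.log_le_log (by linarith) ?_; nlinarith
      _ = 2 * Real.log (T + 7) := by rw [Real.log_pow]; norm_num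
  have hd : 0 ≤ Real.log ((discr K).natAbs : ℝ) := Real.log_natCast_nonneg _
  have hn : (0 : ℝ) ≤ Module.finrank ℚ K := Nat.cast_nonneg _
  have hl0 : 0 ≤ Real.log (|T| + 7) := Real.log_nonneg (by linarith [abs_nonneg T])
  nlinarith

/-- **Good heights for `L₀(·, χ)`, uniformly in the field**: with the absolute `c₀ = 1/4104`, every
interval `[τ₀, τ₀ + 1]`, `τ₀ ≥ 0`, contains a height `T` such that `||γ| − T| ≥ c₀/discBound K T`
for every zero `ρ = β + iγ` of `L₀(s, χ)` with `0 < β < 1`. [cite: MontgomeryVaughan2007, Lemma 12.7] -/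
theorem exists_goodHeight_classGroupLFunction₀ {χ : ClassGroup (𝓞 K) →* ℂˣ} (hχ : χ ≠ 1) {τ₀ : ℝ} (hτ₀ : 0 ≤ τ₀) :
    ∃ T ∈ Set.Icc τ₀ (τ₀ + 1), ∀ ρ : ℂ, classGroupLFunction₀ K χ ρ = 0 → 0 < ρ.re → ρ.re < 1 →
      (1 / 4104) / discBound K T ≤ |(|ρ.im|) - T| := by
  classical
  set f := classGroupLFunction₀ K χ with hf
  have hdf : Differentiable ℂ f := differentiable_classGroupLFunction₀ χ
  -- the zeros of the two windows and their number `M`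
  set Wset : Set ℂ := {ρ | f ρ = 0 ∧ 0 < ρ.re ∧ ρ.re < 1 ∧ |(|ρ.im|) - (τ₀ + 1 / 2)| ≤ 1 / 2} with hWset
  have hWfin : Wset.Finite := by
    refine (finite_zeroBox_classGroupLFunction₀ hχ (τ₀ + 1)).subset ?_
    rintro ρ ⟨h0, h1, h2, h3⟩
    refine ⟨h0, h1, h2, ?_⟩
    rw [abs_le] at h3
    linarith
  set W := hWfin.toFinset with hW
  set M : ℕ := W.card with hM
  have hM1 : (0 : ℝ) < M + 1 := by positivity
  -- pigeonhole
  let φ : ℂ → ℕ := fun ρ ↦ ⌊(|ρ.im| - τ₀) * (M + 1)⌋₊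
  have hcard : (W.image φ).card < (Finset.range (M + 1)).card := by
    rw [Finset.card_range]
    exact Nat.lt_succ_of_le (Finset.card_image_le.trans le_rfl)
  obtain ⟨k, hk, hkφ⟩ := Finset.exists_mem_notMem_of_card_lt_card hcard
  rw [Finset.mem_range] at hk
  set T : ℝ := τ₀ + ((k : ℝ) + 1 / 2) / (M + 1) with hT
  have hk1 : (k : ℝ) + 1 ≤ M + 1 := by exact_mod_cast hk
  have hTlo : τ₀ + (1 / 2) / (M + 1) ≤ T := by
    rw [hT]; gcongr; linarith [(k.cast_nonneg : (0 : ℝ) ≤ k)]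
  have hThi : T ≤ τ₀ + 1 - (1 / 2) / (M + 1) := by
    rw [hT, add_sub_assoc, add_le_add_iff_left, le_sub_iff_add_le, ← add_div, div_le_one hM1]
    linarith
  have hδ0 : (0 : ℝ) < (1 / 2) / (M + 1) := by positivity
  have hT0 : 0 ≤ T := by linarith
  refine ⟨T, ⟨by linarith, by linarith⟩, fun ρ h0 h1 h2 ↦ ?_⟩
  -- Step 1: distance `≥ 1/(2(M+1))`
  have hfar : (1 / 2) / ((M : ℝ) + 1) ≤ |(|ρ.im|) - T| := by
    by_cases hwin : |(|ρ.im|) - (τ₀ + 1 / 2)| ≤ 1 / 2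
    · have hρW : ρ ∈ W := by
        rw [hW, Set.Finite.mem_toFinset]
        exact ⟨h0, h1, h2, hwin⟩
      have hne : φ ρ ≠ k := fun h ↦ hkφ (Finset.mem_image.2 ⟨ρ, hρW, h⟩)
      set y : ℝ := (|ρ.im| - τ₀) * (M + 1) with hy
      have hy0 : 0 ≤ y := by
        rw [abs_le] at hwin
        have : 0 ≤ |ρ.im| - τ₀ := by linarith
        positivity
      have hcase : y < k ∨ (k : ℝ) + 1 ≤ y := by
        by_contra hcon
        rw [not_or, not_lt, not_le] at hcon
        exact hne ((Nat.floor_eq_iff hy0).2 ⟨hcon.1, hcon.2⟩)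
      have hyT : |ρ.im| - T = (y - (k + 1 / 2)) / (M + 1) := by
        rw [hT, hy]; field_simp; ring
      rw [hyT, abs_div, abs_of_pos hM1, div_le_div_iff_of_pos_right hM1]
      rcases hcase with h | h
      · rw [abs_of_neg (by linarith)]; linarith
      · rw [abs_of_nonneg (by linarith)]; linarith
    · rw [not_le] at hwin
      have h1' : |T - (τ₀ + 1 / 2)| ≤ 1 / 2 - (1 / 2) / (M + 1) := by
        rw [abs_le]; constructor <;> linarith
      have h2' := abs_sub_abs_le_abs_sub (|ρ.im| - (τ₀ + 1 / 2)) (T - (τ₀ + 1 / 2))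
      rw [show |ρ.im| - (τ₀ + 1 / 2) - (T - (τ₀ + 1 / 2)) = |ρ.im| - T by ring] at h2'
      linarith
  -- Step 2: `M ≤ 2 · 256 · discBound(τ₀ + 1/2) ≤ 1024 · discBound T`
  refine le_trans ?_ hfar
  set ℒ : ℝ := discBound K T with hℒ
  have hℒ1 : 1 ≤ ℒ := one_le_discBound K T
  have hMle : (M : ℝ) ≤ 2 * (256 * discBound K (τ₀ + 1 / 2)) := by
    have hsum : (M : ℝ) = ∑ ρ ∈ W, (1 : ℝ) := by simp [hM]
    rw [hsum, ← Finset.sum_filter_add_sum_filter_not W (fun ρ : ℂ ↦ 0 ≤ ρ.im), two_mul]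
    have hc2 : f (2 + ((0 : ℝ) : ℂ) * I) ≠ 0 := classGroupLFunction₀_two_add_ne_zero hχ 0
    refine add_le_add ?_ ?_
    · refine le_trans (Finset.sum_le_sum fun ρ hρ ↦ ?_)
        (sum_window_classGroupLFunction₀_le hχ (τ₀ + 1 / 2) _ fun ρ hρ ↦ ?_)
      · rw [Finset.mem_filter, hW, Set.Finite.mem_toFinset] at hρ
        exact_mod_cast (zeroOrder_pos_iff hdf hc2 ρ).2 hρ.1.1
      · rw [Finset.mem_filter, hW, Set.Finite.mem_toFinset] at hρ
        obtain ⟨⟨h0, h1, h2, h3⟩, him⟩ := hρ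
        rw [abs_of_nonneg him] at h3
        exact ⟨h0, h1, h2, h3⟩
    · have h := sum_window_classGroupLFunction₀_le hχ (-(τ₀ + 1 / 2)) (W.filter (fun ρ : ℂ ↦ ¬ 0 ≤ ρ.im)) fun ρ hρ ↦ by
        rw [Finset.mem_filter, hW, Set.Finite.mem_toFinset, not_le] at hρ
        obtain ⟨⟨h0, h1, h2, h3⟩, him⟩ := hρ
        rw [abs_of_neg him] at h3
        refine ⟨h0, h1, h2, ?_⟩
        rwa [sub_neg_eq_add, show ρ.im + (τ₀ + 1 / 2) = -(-ρ.im - (τ₀ + 1 / 2)) by ring, abs_neg]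
      rw [discBound_neg] at h
      refine le_trans (Finset.sum_le_sum fun ρ hρ ↦ ?_) h
      rw [Finset.mem_filter, hW, Set.Finite.mem_toFinset] at hρ
      exact_mod_cast (zeroOrder_pos_iff hdf hc2 ρ).2 hρ.1.1
  have hD2 := discBound_le_two_mul K hτ₀ (show τ₀ ≤ T by linarith)
  have hM' : (M : ℝ) + 1 ≤ 1026 * ℒ := by rw [hℒ]; linarith
  have hℒ0 : 0 < ℒ := by linarith
  rw [div_le_div_iff₀ hℒ0 hM1]
  nlinarith


/-! ### The same for `ζ₁_K` -/

/-- Near every `ρ ≠ 1`, `ζ₁_K(z) = (z − 1) L(z, 1)`, so the orders of `ζ₁_K` and `L(·, 1)` at `ρ` agree. [folklore] -/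
theorem analyticOrderAt_dedekindZeta₁_eq {ρ : ℂ} (hρ : ρ ≠ 1) :
    analyticOrderAt (dedekindZeta₁ K) ρ = analyticOrderAt (classGroupLFunction K 1) ρ := by
  have heq : dedekindZeta₁ K =ᶠ[𝓝 ρ] fun z ↦ (z - 1) * classGroupLFunction K 1 z := by
    filter_upwards [isOpen_compl_singleton.mem_nhds hρ] with z hz
    rw [dedekindZeta₁_apply_of_ne_one hz, classGroupLFunction_one K hz]
  rw [analyticOrderAt_congr heq]
  exact analyticOrderAt_mul_of_ne_zero (analyticAt_id.sub analyticAt_const) (sub_ne_zero.2 hρ)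
    (analyticAt_classGroupLFunction 1 hρ)

/-- The multiplicity of `ζ₁_K` under the reflection: for a non-trivial zero `ρ` (`0 < β < 1`),
`m(ρ) = m(1 − ρ)`. [folklore] -/
theorem zeroOrder_dedekindZeta₁_reflect {ρ : ℂ} (h1 : 0 < ρ.re) (h2 : ρ.re < 1) :
    zeroOrder (dedekindZeta₁ K) ρ = zeroOrder (dedekindZeta₁ K) (1 - ρ) := by
  have hρ1 : ρ ≠ 1 := fun h ↦ by rw [h, one_re] at h2; exact lt_irrefl _ h2
  have h1ρ1 : 1 - ρ ≠ 1 := fun h ↦ by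
    have := congrArg Complex.re h; simp at this; linarith
  have hs : ∀ n : ℤ, 1 - ρ ≠ n := by
    refine ne_int_of_mem_strip ?_ ?_
    · simp only [sub_re, one_re]; linarith
    · simp only [sub_re, one_re]; linarith
  have h := analyticOrderAt_classGroupLFunction_one_sub (K := K) 1 hs
  have hinv : (1 : ClassGroup (𝓞 K) →* ℂˣ)⁻¹ = 1 := by ext C; simp
  rw [sub_sub_cancel, hinv] at h
  have hdf : Differentiable ℂ (dedekindZeta₁ K) := differentiable_dedekindZeta₁ K
  have hc2 : dedekindZeta₁ K 2 ≠ 0 := dedekindZeta₁_ne_zero_of_one_le_re (by norm_num)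
  have hne : ∀ u : ℂ, analyticOrderAt (dedekindZeta₁ K) u ≠ ⊤ := fun u ↦ analyticOrderAt_ne_top hdf hc2 u
  have : (zeroOrder (dedekindZeta₁ K) ρ : ℕ∞) = zeroOrder (dedekindZeta₁ K) (1 - ρ) := by
    rw [zeroOrder, zeroOrder, Nat.cast_analyticOrderNatAt (hne ρ), Nat.cast_analyticOrderNatAt (hne (1 - ρ)),
      analyticOrderAt_dedekindZeta₁_eq hρ1, analyticOrderAt_dedekindZeta₁_eq h1ρ1, h]
  exact_mod_cast this

/-- `ζ₁_K(1 − ρ) = 0` for a non-trivial zero `ρ` of `ζ_K`. [folklore] -/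
theorem dedekindZeta₁_one_sub_eq_zero {ρ : ℂ} (h0 : dedekindZeta₁ K ρ = 0) (h1 : 0 < ρ.re) (h2 : ρ.re < 1) :
    dedekindZeta₁ K (1 - ρ) = 0 := by
  have hdf := differentiable_dedekindZeta₁ K
  have hc : dedekindZeta₁ K 2 ≠ 0 := dedekindZeta₁_ne_zero_of_one_le_re (by norm_num)
  have hpos : 0 < zeroOrder (dedekindZeta₁ K) ρ := (zeroOrder_pos_iff hdf hc ρ).2 h0
  rw [zeroOrder_dedekindZeta₁_reflect h1 h2] at hpos
  exact (zeroOrder_pos_iff hdf hc (1 - ρ)).1 hpos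

/-- `ζ₁_K(2 + iτ) ≠ 0`. [folklore] -/
theorem dedekindZeta₁_two_add_ne_zero' (τ : ℝ) : dedekindZeta₁ K (2 + (τ : ℂ) * I) ≠ 0 :=
  dedekindZeta₁_ne_zero_of_one_le_re (by simp)

/-- **Zeros of `ζ_K` in a unit window, uniformly in the field**: for every finite set `P` of zeros of
`ζ_K` with `0 < β < 1`, `|γ − τ| ≤ 1/2`: `Σ_{ρ ∈ P} m(ρ) ≤ 64 · discBound K τ`.
[cite: LagariasOdlyzko1977, Lemma 5.4] -/
theorem sum_window_dedekindZeta₁_le (τ : ℝ) (P : Finset ℂ)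
    (hP : ∀ ρ ∈ P, dedekindZeta₁ K ρ = 0 ∧ 0 < ρ.re ∧ ρ.re < 1 ∧ |ρ.im - τ| ≤ 1 / 2) :
    ∑ ρ ∈ P, (zeroOrder (dedekindZeta₁ K) ρ : ℝ) ≤ 64 * discBound K τ := by
  classical
  set f := dedekindZeta₁ K with hf
  have hdf : Differentiable ℂ f := differentiable_dedekindZeta₁ K
  have hfc : f (2 + (τ : ℂ) * I) ≠ 0 := dedekindZeta₁_two_add_ne_zero' τ
  have hgc : f (2 + ((-τ : ℝ) : ℂ) * I) ≠ 0 := dedekindZeta₁_two_add_ne_zero' (-τ)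
  rw [← sum_filter_add_sum_filter_not P (fun ρ : ℂ ↦ (1 / 2 : ℝ) ≤ ρ.re),
    show (64 : ℝ) * discBound K τ = 32 * discBound K τ + 32 * discBound K (-τ) by rw [discBound_neg]; ring]
  refine add_le_add ?_ ?_
  · have hsub : P.filter (fun ρ : ℂ ↦ (1 / 2 : ℝ) ≤ ρ.re) ⊆ discZeros f τ := by
      intro ρ hρ
      rw [mem_filter] at hρ
      obtain ⟨h0, -, h2, h3⟩ := hP ρ hρ.1
      exact (mem_discZeros hdf hfc).2 ⟨mem_closedBall_of_window hρ.2 (by linarith) h3, h0⟩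
    calc ∑ ρ ∈ P.filter (fun ρ : ℂ ↦ (1 / 2 : ℝ) ≤ ρ.re), (zeroOrder f ρ : ℝ)
        = ∑ ρ ∈ P.filter (fun ρ : ℂ ↦ (1 / 2 : ℝ) ≤ ρ.re), (discDivisor f τ ρ : ℝ) := by
          refine sum_congr rfl fun ρ hρ ↦ ?_
          rw [discDivisor_eq_zeroOrder hdf hfc ((mem_discZeros hdf hfc).1 (hsub hρ)).1]; norm_cast
      _ ≤ ∑ ρ ∈ discZeros f τ, (discDivisor f τ ρ : ℝ) :=
          sum_le_sum_of_subset_of_nonneg hsub fun ρ _ _ ↦ by exact_mod_cast discDivisor_nonneg hdf _ ρ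
      _ ≤ 32 * discBound K τ := sum_divisor_dedekindZeta₁_bigDisc_le (K := K) τ
  · set P' := P.filter (fun ρ : ℂ ↦ ¬ (1 / 2 : ℝ) ≤ ρ.re) with hP'
    have hinj : Set.InjOn (fun ρ : ℂ ↦ 1 - ρ) ↑P' := fun a _ b _ h ↦ sub_right_injective h
    have heq : ∑ ρ ∈ P', (zeroOrder f ρ : ℝ) = ∑ u ∈ P'.image (fun ρ : ℂ ↦ 1 - ρ), (zeroOrder f u : ℝ) := by
      rw [sum_image hinj]
      refine sum_congr rfl fun ρ hρ ↦ ?_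
      obtain ⟨-, h1, h2, -⟩ := hP ρ (mem_filter.1 hρ).1
      rw [zeroOrder_dedekindZeta₁_reflect h1 h2]
    have hsub : P'.image (fun ρ : ℂ ↦ 1 - ρ) ⊆ discZeros f (-τ) := by
      intro u hu
      obtain ⟨ρ, hρ, rfl⟩ := mem_image.1 hu
      obtain ⟨h0, h1, h2, h3⟩ := hP ρ (mem_filter.1 hρ).1
      have hlt : ρ.re < 1 / 2 := not_le.1 (mem_filter.1 hρ).2
      refine (mem_discZeros hdf hgc).2 ⟨?_, dedekindZeta₁_one_sub_eq_zero h0 h1 h2⟩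
      refine mem_closedBall_of_window (τ := -τ) ?_ ?_ ?_
      · simp only [sub_re, one_re]; linarith
      · simp only [sub_re, one_re]; linarith
      · simp only [sub_im, one_im, zero_sub]
        rw [show -ρ.im - -τ = -(ρ.im - τ) by ring, abs_neg]; exact h3
    rw [heq]
    calc ∑ u ∈ P'.image (fun ρ : ℂ ↦ 1 - ρ), (zeroOrder f u : ℝ)
        = ∑ u ∈ P'.image (fun ρ : ℂ ↦ 1 - ρ), (discDivisor f (-τ) u : ℝ) := by
          refine sum_congr rfl fun u hu ↦ ?_
          rw [discDivisor_eq_zeroOrder hdf hgc ((mem_discZeros hdf hgc).1 (hsub hu)).1]; norm_cast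
      _ ≤ ∑ u ∈ discZeros f (-τ), (discDivisor f (-τ) u : ℝ) :=
          sum_le_sum_of_subset_of_nonneg hsub fun u _ _ ↦ by exact_mod_cast discDivisor_nonneg hdf _ u
      _ ≤ 32 * discBound K (-τ) := sum_divisor_dedekindZeta₁_bigDisc_le (K := K) (-τ)

/-- The zeros of `ζ₁_K` in a compact set are finite. [folklore] -/
theorem finite_zeros_dedekindZeta₁ {S : Set ℂ} (hS : IsCompact S) : (S ∩ dedekindZeta₁ K ⁻¹' {0}).Finite := by
  have han : AnalyticOnNhd ℂ (dedekindZeta₁ K) univ :=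
    (differentiable_dedekindZeta₁ K).differentiableOn.analyticOnNhd isOpen_univ
  have h2 : dedekindZeta₁ K 2 ≠ 0 := dedekindZeta₁_ne_zero_of_one_le_re (by norm_num)
  have hcod := han.preimage_zero_mem_codiscreteWithin (x := 2) h2 (mem_univ _) isConnected_univ
  have hclosed : IsClosed (dedekindZeta₁ K ⁻¹' {0}) := by
    simpa using (mem_codiscrete'.mp hcod).1
  have hdisc : IsDiscrete (dedekindZeta₁ K ⁻¹' {0}) := by
    simpa using (mem_codiscrete'.mp hcod).2
  exact (hS.inter_right hclosed).finite (hdisc.mono inter_subset_right)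

/-- The non-trivial zeros of `ζ_K` with `|γ| ≤ Y` form a finite set. [folklore] -/
theorem finite_zeroBox_dedekindZeta₁ (Y : ℝ) :
    {ρ : ℂ | dedekindZeta₁ K ρ = 0 ∧ 0 < ρ.re ∧ ρ.re < 1 ∧ |ρ.im| ≤ Y}.Finite := by
  refine (finite_zeros_dedekindZeta₁ (K := K) ((isCompact_Icc (a := (0:ℝ)) (b := 1)).reProdIm
    (isCompact_Icc (a := -Y) (b := Y)))).subset ?_
  rintro ρ ⟨h0, h1, h2, h3⟩
  exact ⟨Complex.mem_reProdIm.2 ⟨⟨h1.le, h2.le⟩, abs_le.1 h3⟩, h0⟩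

/-- **Good heights for `ζ_K`, uniformly in the field**: every `[τ₀, τ₀ + 1]`, `τ₀ ≥ 0`, contains a
height `T` with `||γ| − T| ≥ (1/1032)/discBound K T` for every non-trivial zero of `ζ_K`.
[cite: MontgomeryVaughan2007, Lemma 12.2] -/
theorem exists_goodHeight_dedekindZeta₁ {τ₀ : ℝ} (hτ₀ : 0 ≤ τ₀) :
    ∃ T ∈ Set.Icc τ₀ (τ₀ + 1), ∀ ρ : ℂ, dedekindZeta₁ K ρ = 0 → 0 < ρ.re → ρ.re < 1 →
      (1 / 1032) / discBound K T ≤ |(|ρ.im|) - T| := by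
  classical
  set f := dedekindZeta₁ K with hf
  have hdf : Differentiable ℂ f := differentiable_dedekindZeta₁ K
  have hc2 : f 2 ≠ 0 := dedekindZeta₁_ne_zero_of_one_le_re (by norm_num)
  set Wset : Set ℂ := {ρ | f ρ = 0 ∧ 0 < ρ.re ∧ ρ.re < 1 ∧ |(|ρ.im|) - (τ₀ + 1 / 2)| ≤ 1 / 2} with hWset
  have hWfin : Wset.Finite := by
    refine (finite_zeroBox_dedekindZeta₁ (K := K) (τ₀ + 1)).subset ?_
    rintro ρ ⟨h0, h1, h2, h3⟩
    refine ⟨h0, h1, h2, ?_⟩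
    rw [abs_le] at h3
    linarith
  set W := hWfin.toFinset with hW
  set M : ℕ := W.card with hM
  have hM1 : (0 : ℝ) < M + 1 := by positivity
  let φ : ℂ → ℕ := fun ρ ↦ ⌊(|ρ.im| - τ₀) * (M + 1)⌋₊
  have hcard : (W.image φ).card < (Finset.range (M + 1)).card := by
    rw [Finset.card_range]
    exact Nat.lt_succ_of_le (Finset.card_image_le.trans le_rfl)
  obtain ⟨k, hk, hkφ⟩ := Finset.exists_mem_notMem_of_card_lt_card hcard
  rw [Finset.mem_range] at hk
  set T : ℝ := τ₀ + ((k : ℝ) + 1 / 2) / (M + 1) with hT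
  have hk1 : (k : ℝ) + 1 ≤ M + 1 := by exact_mod_cast hk
  have hTlo : τ₀ + (1 / 2) / (M + 1) ≤ T := by
    rw [hT]; gcongr; linarith [(k.cast_nonneg : (0 : ℝ) ≤ k)]
  have hThi : T ≤ τ₀ + 1 - (1 / 2) / (M + 1) := by
    rw [hT, add_sub_assoc, add_le_add_iff_left, le_sub_iff_add_le, ← add_div, div_le_one hM1]
    linarith
  have hδ0 : (0 : ℝ) < (1 / 2) / (M + 1) := by positivity
  have hT0 : 0 ≤ T := by linarith
  refine ⟨T, ⟨by linarith, by linarith⟩, fun ρ h0 h1 h2 ↦ ?_⟩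
  have hfar : (1 / 2) / ((M : ℝ) + 1) ≤ |(|ρ.im|) - T| := by
    by_cases hwin : |(|ρ.im|) - (τ₀ + 1 / 2)| ≤ 1 / 2
    · have hρW : ρ ∈ W := by
        rw [hW, Set.Finite.mem_toFinset]
        exact ⟨h0, h1, h2, hwin⟩
      have hne : φ ρ ≠ k := fun h ↦ hkφ (Finset.mem_image.2 ⟨ρ, hρW, h⟩)
      set y : ℝ := (|ρ.im| - τ₀) * (M + 1) with hy
      have hy0 : 0 ≤ y := by
        rw [abs_le] at hwin
        have : 0 ≤ |ρ.im| - τ₀ := by linarith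
        positivity
      have hcase : y < k ∨ (k : ℝ) + 1 ≤ y := by
        by_contra hcon
        rw [not_or, not_lt, not_le] at hcon
        exact hne ((Nat.floor_eq_iff hy0).2 ⟨hcon.1, hcon.2⟩)
      have hyT : |ρ.im| - T = (y - (k + 1 / 2)) / (M + 1) := by
        rw [hT, hy]; field_simp; ring
      rw [hyT, abs_div, abs_of_pos hM1, div_le_div_iff_of_pos_right hM1]
      rcases hcase with h | h
      · rw [abs_of_neg (by linarith)]; linarith
      · rw [abs_of_nonneg (by linarith)]; linarith
    · rw [not_le] at hwin
      have h1' : |T - (τ₀ + 1 / 2)| ≤ 1 / 2 - (1 / 2) / (M + 1) := by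
        rw [abs_le]; constructor <;> linarith
      have h2' := abs_sub_abs_le_abs_sub (|ρ.im| - (τ₀ + 1 / 2)) (T - (τ₀ + 1 / 2))
      rw [show |ρ.im| - (τ₀ + 1 / 2) - (T - (τ₀ + 1 / 2)) = |ρ.im| - T by ring] at h2'
      linarith
  refine le_trans ?_ hfar
  set ℒ : ℝ := discBound K T with hℒ
  have hℒ1 : 1 ≤ ℒ := one_le_discBound K T
  have hMle : (M : ℝ) ≤ 2 * (64 * discBound K (τ₀ + 1 / 2)) := by
    have hsum : (M : ℝ) = ∑ ρ ∈ W, (1 : ℝ) := by simp [hM]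
    rw [hsum, ← Finset.sum_filter_add_sum_filter_not W (fun ρ : ℂ ↦ 0 ≤ ρ.im), two_mul]
    refine add_le_add ?_ ?_
    · refine le_trans (Finset.sum_le_sum fun ρ hρ ↦ ?_)
        (sum_window_dedekindZeta₁_le (K := K) (τ₀ + 1 / 2) _ fun ρ hρ ↦ ?_)
      · rw [Finset.mem_filter, hW, Set.Finite.mem_toFinset] at hρ
        exact_mod_cast (zeroOrder_pos_iff hdf hc2 ρ).2 hρ.1.1
      · rw [Finset.mem_filter, hW, Set.Finite.mem_toFinset] at hρ
        obtain ⟨⟨h0, h1, h2, h3⟩, him⟩ := hρ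
        rw [abs_of_nonneg him] at h3
        exact ⟨h0, h1, h2, h3⟩
    · have h := sum_window_dedekindZeta₁_le (K := K) (-(τ₀ + 1 / 2)) (W.filter (fun ρ : ℂ ↦ ¬ 0 ≤ ρ.im)) fun ρ hρ ↦ by
        rw [Finset.mem_filter, hW, Set.Finite.mem_toFinset, not_le] at hρ
        obtain ⟨⟨h0, h1, h2, h3⟩, him⟩ := hρ
        rw [abs_of_neg him] at h3
        refine ⟨h0, h1, h2, ?_⟩
        rwa [sub_neg_eq_add, show ρ.im + (τ₀ + 1 / 2) = -(-ρ.im - (τ₀ + 1 / 2)) by ring, abs_neg]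
      rw [discBound_neg] at h
      refine le_trans (Finset.sum_le_sum fun ρ hρ ↦ ?_) h
      rw [Finset.mem_filter, hW, Set.Finite.mem_toFinset] at hρ
      exact_mod_cast (zeroOrder_pos_iff hdf hc2 ρ).2 hρ.1.1
  have hD2 := discBound_le_two_mul K hτ₀ (show τ₀ ≤ T by linarith)
  have hM' : (M : ℝ) + 1 ≤ 258 * ℒ := by rw [hℒ]; linarith
  have hℒ0 : 0 < ℒ := by linarith
  rw [div_le_div_iff₀ hℒ0 hM1]
  nlinarith

end Literature.NumberTheory.LFunctions.NumberField

end
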